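import Mathlib
import HarnessLib
import Summits.HubbardSuperconductivity.HubbardSuperconductivity.Theorems.BalabanIRBirComplexStableXYFixedVolumeLaplace
import Summits.HubbardSuperconductivity.HubbardSuperconductivity.Theorems.BalabanIRBirComplexStableXYFixedVolumeGauss

/-!
# BalabanIR engine `BirComplexStableXY` (stmt-HubbardSuperconductivity-2080): a uniform lower
bound for complex Gaussian integrals

Support lemmas for crux 2 of route BalabanIR (`--supports stmt-HubbardSuperconductivity-2080`),
quantitative companion of `BalabanIRBirComplexStableXYFixedVolumeGauss.lean` (abstract part,
no definitions).  For any real `β` and `m > 0` the set of coefficient arrays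
`Q : ι → ι → ℂ` which are symmetric, entrywise bounded by `β`, and whose quadratic form
`q u = ½ Σ_{ij} Q_{ij} u_i u_j` satisfies `m Σ u_i² ≤ Re (q u)` is compact; the Gaussian integral
`Q ↦ ∫ e^{−q}` is continuous on it (dominated convergence) and nowhere zero
(`birGauss_integral_ne_zero`), hence bounded below by a positive constant
(`birGauss_uniform_lower_bound`).  This removes the last `c`-dependence from the fixed-volume
Laplace asymptotics of the typed engine class.
-/

namespace Summit.HubbardSuperconductivity.HubbardSuperconductivity.Theorems

open scoped BigOperators
open MeasureTheory Filter Topology Set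

section GaussCompact

variable {ι : Type*} [Fintype ι] [DecidableEq ι]

omit [DecidableEq ι] in
/-- The quadratic form `½ Σ Q_{ij} u_i u_j` is continuous in the coefficient array `Q`. -/
theorem birGaussC_continuous_form (u : ι → ℝ) :
    Continuous fun Q : ι → ι → ℂ => (1 / 2 : ℂ) * ∑ i, ∑ j, Q i j * u i * u j := by
  refine continuous_const.mul (continuous_finsetSum _ fun i _ => ?_)
  refine continuous_finsetSum _ fun j _ => ?_
  exact ((continuous_apply_apply i j).mul continuous_const).mul continuous_const

/-- **Uniform lower bound for the complex Gaussian integral.**  There is `g₀ > 0` such that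
`g₀ ≤ ‖∫ exp (−½ Σ Q_{ij} u_i u_j) du‖` for every symmetric `Q` with `‖Q_{ij}‖ ≤ β` and
`m Σ u_i² ≤ Re (½ Σ Q_{ij} u_i u_j)` (`m > 0`). -/
theorem birGauss_uniform_lower_bound (β : ℝ) {m : ℝ} (hm : 0 < m) :
    ∃ g₀ : ℝ, 0 < g₀ ∧ ∀ Q : ι → ι → ℂ, (∀ i j, Q i j = Q j i) → (∀ i j, ‖Q i j‖ ≤ β) →
      (∀ u : ι → ℝ, m * ∑ i, u i ^ 2 ≤ ((1 / 2 : ℂ) * ∑ i, ∑ j, Q i j * u i * u j).re) →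
      g₀ ≤ ‖∫ u : ι → ℝ, Complex.exp (-((1 / 2 : ℂ) * ∑ i, ∑ j, Q i j * u i * u j))‖ := by
  -- the parameter set
  set 𝒬 : Set (ι → ι → ℂ) := {Q | (∀ i j, Q i j = Q j i) ∧ (∀ i j, ‖Q i j‖ ≤ β) ∧
      ∀ u : ι → ℝ, m * ∑ i, u i ^ 2 ≤ ((1 / 2 : ℂ) * ∑ i, ∑ j, Q i j * u i * u j).re} with h𝒬
  set G : (ι → ι → ℂ) → ℂ := fun Q =>
      ∫ u : ι → ℝ, Complex.exp (-((1 / 2 : ℂ) * ∑ i, ∑ j, Q i j * u i * u j)) with hG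
  -- compactness
  have hclosed : IsClosed 𝒬 := by
    have h1 : IsClosed {Q : ι → ι → ℂ | ∀ i j, Q i j = Q j i} := by
      simp only [Set.setOf_forall]
      refine isClosed_iInter fun i => isClosed_iInter fun j => ?_
      exact isClosed_eq (continuous_apply_apply i j) (continuous_apply_apply j i)
    have h2 : IsClosed {Q : ι → ι → ℂ | ∀ i j, ‖Q i j‖ ≤ β} := by
      simp only [Set.setOf_forall]
      refine isClosed_iInter fun i => isClosed_iInter fun j => ?_
      exact isClosed_le (continuous_apply_apply i j).norm continuous_const
    have h3 : IsClosed {Q : ι → ι → ℂ | ∀ u : ι → ℝ,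
        m * ∑ i, u i ^ 2 ≤ ((1 / 2 : ℂ) * ∑ i, ∑ j, Q i j * u i * u j).re} := by
      simp only [Set.setOf_forall]
      refine isClosed_iInter fun u => ?_
      exact isClosed_le continuous_const (Complex.continuous_re.comp (birGaussC_continuous_form u))
    have : 𝒬 = {Q : ι → ι → ℂ | ∀ i j, Q i j = Q j i} ∩ ({Q : ι → ι → ℂ | ∀ i j, ‖Q i j‖ ≤ β} ∩
        {Q : ι → ι → ℂ | ∀ u : ι → ℝ,
          m * ∑ i, u i ^ 2 ≤ ((1 / 2 : ℂ) * ∑ i, ∑ j, Q i j * u i * u j).re}) := by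
      ext Q; simp [h𝒬]
    rw [this]
    exact h1.inter (h2.inter h3)
  have hbdd : Bornology.IsBounded 𝒬 := by
    refine (Metric.isBounded_closedBall (x := (0 : ι → ι → ℂ)) (r := max β 0)).subset ?_
    intro Q hQ
    rw [Metric.mem_closedBall, dist_zero_right]
    refine (pi_norm_le_iff_of_nonneg (le_max_right _ _)).2 fun i => ?_
    refine (pi_norm_le_iff_of_nonneg (le_max_right _ _)).2 fun j => ?_
    exact (hQ.2.1 i j).trans (le_max_left _ _)
  have hcompact : IsCompact 𝒬 := Metric.isCompact_of_isClosed_isBounded hclosed hbdd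
  -- continuity of `G` on `𝒬`
  have hGcont : ContinuousOn G 𝒬 := by
    refine continuousOn_of_dominated (bound := fun u : ι → ℝ => 1 * Real.exp (-m * ∑ i, u i ^ 2))
      ?_ ?_ (birLaplace_integrable_gaussian hm 1) ?_
    · intro Q _
      exact (Continuous.aestronglyMeasurable (by fun_prop))
    · intro Q hQ
      refine Eventually.of_forall fun u => ?_
      rw [Complex.norm_exp, Complex.neg_re, one_mul, Real.exp_le_exp]
      linarith [hQ.2.2 u]
    · refine Eventually.of_forall fun u => ?_
      exact (Complex.continuous_exp.comp (birGaussC_continuous_form u).neg).continuousOn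
  -- the minimum of `‖G‖` on `𝒬`
  by_cases hne : 𝒬.Nonempty
  · obtain ⟨Q₀, hQ₀, hmin⟩ :=
      hcompact.exists_isMinOn hne (continuous_norm.comp_continuousOn hGcont)
    have hG0 : G Q₀ ≠ 0 := by
      have hsymm : (Matrix.of fun i j => Q₀ i j).IsSymm :=
        Matrix.IsSymm.ext fun i j => by simp only [Matrix.of_apply]; exact hQ₀.1 j i
      have hpos : ∀ u : ι → ℝ, u ≠ 0 →
          0 < (∑ i, ∑ j, (Matrix.of fun i j => Q₀ i j) i j * u i * u j).re := by
        intro u hu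
        simp only [Matrix.of_apply]
        obtain ⟨i, hi⟩ : ∃ i, u i ≠ 0 := by
          by_contra h
          push Not at h
          exact hu (funext h)
        have hsq : 0 < ∑ j, u j ^ 2 := by
          have h1 : 0 < u i ^ 2 := by positivity
          have h2 : u i ^ 2 ≤ ∑ j, u j ^ 2 :=
            Finset.single_le_sum (f := fun j => u j ^ 2) (fun j _ => sq_nonneg (u j))
              (Finset.mem_univ i)
          linarith
        have h := hQ₀.2.2 u
        have h2 : ((1 / 2 : ℂ) * ∑ i, ∑ j, Q₀ i j * u i * u j).re
            = (1 / 2) * (∑ i, ∑ j, Q₀ i j * u i * u j).re := by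
          simp [Complex.mul_re]
        rw [h2] at h
        nlinarith
      have h := birGauss_integral_ne_zero (Matrix.of fun i j => Q₀ i j) hsymm hpos
      simpa only [Matrix.of_apply, neg_mul, hG] using h
    refine ⟨‖G Q₀‖, norm_pos_iff.2 hG0, fun Q h1 h2 h3 => ?_⟩
    have hQ : Q ∈ 𝒬 := ⟨h1, h2, h3⟩
    exact hmin hQ
  · refine ⟨1, one_pos, fun Q h1 h2 h3 => ?_⟩
    exact absurd ⟨Q, h1, h2, h3⟩ hne

end GaussCompact

end Summit.HubbardSuperconductivity.HubbardSuperconductivity.Theorems
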